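import Literature.NumberTheory.Transcendental.QuadraticRelationsLogarithmsSec5Tilde
import Literature.NumberTheory.Transcendental.QuadraticRelationsLogarithmsSec5Box
import Literature.NumberTheory.Transcendental.QuadraticRelationsLogarithmsSec5FF
import Literature.NumberTheory.Transcendental.QuadraticRelationsLogarithmsSec5Numerics
import Literature.NumberTheory.Transcendental.QuadraticRelationsLogarithmsWeilHeight
import HarnessLib

/-!
# Roy–Waldschmidt 1997, §5: the proof of Théorème 5.1 at a fixed place (the local assembly)

D. Roy, M. Waldschmidt, *Approximation diophantienne et indépendance algébrique de logarithmes*,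
Ann. Sci. ÉNS (4) 30 (1997) 753–796, proof of Théorème 5.1, pp. 780–783.

Once the bases `η₁, …, η_{ℓ₁}` of `Y` (adapted to `Y_a`), `w₁, …, w_{ℓ₀}` of `W`, the parameters
`κ`, `D`, and the place `𝔭` of degree `D` with its reduction map `r` (Théorème 3.1) are fixed, the
proof of Théorème 5.1 (pp. 781–783) runs: the points `γ̃_j = r(γ_j)`, `η̃_j` (principal logarithm),
`w̃_j = r(w_j)`; Théorème 2.1 applied to this data in the number field `K̃` gives the obstruction
subgroup `H`; Théorème 4.1 lifts it to `L = L₀ × H₁` defined over `K`; and the conclusion of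
Théorème 2.1 combined with the count of the classes of `Σ` modulo `L` yields the product
inequality `T₀^{ℓ₀'} S₁^{λₐ'} S_{ℓ₁}^{λ'-λₐ'} ≤ c T₀^{d₀'} T₁^{d₁'}` from which (5.3) follows
(`…Sec5Params.lean`, `…Sec5Endgame.lean`).

This file proves exactly that step, `sec5_local`, with Théorème 2.1 of the paper (= Waldschmidt,
J. reine angew. Math. 493 (1997), Thm. 2.1, in the special case `T₁ = ⋯ = T_{d₁}`, `S₁ = ⋯ = S_{ℓ₀}`
used here) and Théorème 4.1 as explicit hypotheses `h21`, `h41` (their statements in the tree's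
vocabulary), all numerical side conditions being discharged from the explicit parameter bounds of
`…Sec5Numerics.lean`.  No definitions, no named facts.

## References

* [RoyWaldschmidt1997ENS] D. Roy, M. Waldschmidt, Ann. Sci. ÉNS (4) 30 (1997) 753–796, proof of
  Théorème 5.1, pp. 780–783; Théorème 2.1 pp. 761–762; Théorème 4.1 p. 772.
* [Waldschmidt1997Crelle] M. Waldschmidt, *Approximation diophantienne dans les groupes algébriques
  commutatifs (I)*, J. reine angew. Math. 493 (1997) 61–113, Théorème 2.1.
-/

noncomputable section

open Complex IntermediateField Module Submodule

namespace Literature.NumberTheory.Transcendental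

namespace RoyWaldschmidt1997

open LiePresentation LinGroup
open Literature.NumberTheory.DiophantineGeometry
open Literature.NumberTheory.DiophantineGeometry.AlgFunctionField

variable {K : IntermediateField ℚ ℂ}

set_option maxHeartbeats 2000000 in
/-- **The proof of Théorème 5.1 at a fixed place.** With the data of p. 780–781 (adapted basis `η`
of `Y`, `K`-basis `w` of `W`), the parameters of p. 781 at `(κ, D)`, a place `𝔭` of degree `D`
with reduction map `τ` into the number field `K̃` (`[K̃ : ℚ] = D`) approximating the data to
`exp(-κD²/c)` with heights `≤ κ` (the output of Théorème 3.1), Théorème 2.1 (`h21`) and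
Théorème 4.1 (`h41`) produce an algebraic subgroup `L = L₀ × L₁ ≠ G` with `L₀` defined over `K`
satisfying the product inequality `T₀^{ℓ₀'} S₁^{λₐ'} S_{ℓ₁}^{λ'-λₐ'} ≤ c T₀^{d₀'} T₁^{d₁'}`
(p. 783, display before (5.3)). [cite: RoyWaldschmidt1997ENS, proof of Théorème 5.1, pp. 781–783] -/
theorem sec5_local
    (h21 : ∀ (d₀ d₁ ℓ₀ : ℕ) (N : Type) [Fintype N] (w : Fin ℓ₀ → (Fin d₀ → ℂ) × (Fin d₁ → ℂ))
      (η : N → (Fin d₀ → ℂ) × (Fin d₁ → ℂ))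
      (Kt : IntermediateField ℚ ℂ) [FiniteDimensional ℚ Kt]
      (wt : Fin ℓ₀ → (Fin d₀ → ℂ) × (Fin d₁ → ℂ)) (ηt : N → (Fin d₀ → ℂ) × (Fin d₁ → ℂ))
      (A : Fin d₁ → ℝ) (B₁ B₂ E U V : ℝ) (S₀ T₀ T₁ : ℕ),
      (∀ j, (∀ i, (wt j).1 i ∈ Kt) ∧ ∀ i, (wt j).2 i ∈ Kt) →
      (∀ j, (∀ i, (ηt j).1 i ∈ Kt) ∧ ∀ i, cexp ((ηt j).2 i) ∈ Kt) →
      (∃ j, LinGroup.exp (ηt j) = 1) →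
      (∃ j, (η j).2 ≠ 0) →
      (∀ i, Real.exp 1 ≤ A i) → Real.exp 1 ≤ B₁ → Real.exp 1 ≤ B₂ → Real.exp 1 ≤ E → 0 < U → 0 < V →
      0 < S₀ → 0 < T₀ → 0 < T₁ → 2 * ((d₀ : ℝ) + d₁) ≤ B₁ → ((d₀ : ℝ) + d₁) ≤ B₂ →
      (∀ i : Fin d₀, weilHeight₁ Kt (fun j : N => (ηt j).1 i) ≤ Real.log B₁) →
      (∀ j, weilHeight₁ Kt (Sum.elim (wt j).1 (wt j).2 : Fin d₀ ⊕ Fin d₁ → ℂ) ≤ Real.log B₂) →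
      (∀ (i : Fin d₁) (j : N), weilHeight₁ Kt (fun _ : Unit => cexp ((ηt j).2 i)) ≤ Real.log (A i) ∧
        2 / (Module.finrank ℚ Kt : ℝ) ≤ Real.log (A i) ∧
        E / (Module.finrank ℚ Kt : ℝ) * ‖(ηt j).2 i‖ ≤ Real.log (A i)) →
      (∀ j, ‖w j - wt j‖ ≤ Real.exp (-V)) → (∀ j, ‖η j - ηt j‖ ≤ Real.exp (-V)) →
      (Module.finrank ℚ Kt : ℝ) * (T₀ * Real.log B₁) ≤ U →
      (Module.finrank ℚ Kt : ℝ) * (S₀ * Real.log B₂) ≤ U →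
      (Module.finrank ℚ Kt : ℝ) * (T₁ * ∑ i, Real.log (A i)) ≤ U →
      (12 * ((d₀ : ℝ) + d₁) + 13) * U ≤ V →
      Real.log E ≤ (Module.finrank ℚ Kt : ℝ) * Real.log B₁ →
      Real.log E ≤ (Module.finrank ℚ Kt : ℝ) * Real.log B₂ →
      ((d₀ : ℝ) + d₁) * S₀ + T₀ + d₁ * T₁ ≤ B₂ →
      ((Nat.choose (T₀ + d₀) d₀ : ℝ) * ((T₁ : ℝ) + 1) ^ d₁ ≤ 1 / 8 * Real.exp (U / (2 * Module.finrank ℚ Kt))) →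
      (4 * (V / Real.log E) ^ (Module.finrank ℂ (Submodule.span ℂ (Set.range w ∪ Set.range η))) ≤
        (Nat.choose (T₀ + d₀) d₀ : ℝ) * ((T₁ : ℝ) + 1) ^ d₁) →
      ∃ H : LinGroup.ConnAlgSubgroup d₀ d₁,
        H.tangent ≠ ⊤ ∧ LiePresentation.IsKRational Kt H.addPart ∧
        (∃ F : Set (MvPolynomial (Fin d₀ ⊕ Fin d₁) ℂ),
          (∀ P ∈ F, (∀ m, P.coeff m ∈ Kt) ∧ ∀ i : Fin d₁, P.degreeOf (Sum.inr i) ≤ T₁) ∧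
          (∀ g ∈ H.toSubgroup, ∀ P ∈ F, LinGroup.evalAt P g = 0) ∧
          ∀ H' : LinGroup.ConnAlgSubgroup d₀ d₁, H.toSubgroup ≤ H'.toSubgroup →
            (∀ g ∈ H'.toSubgroup, ∀ P ∈ F, LinGroup.evalAt P g = 0) → H'.toSubgroup = H.toSubgroup) ∧
        S₀ ^ (Module.finrank Kt ↥(Submodule.span Kt (Set.range wt)) -
            Module.finrank Kt ↥(Submodule.span Kt (Set.range wt) ⊓ (H.tangent.restrictScalars Kt))) *
          Set.ncard ((QuotientGroup.mk : LinGroup d₀ d₁ → LinGroup d₀ d₁ ⧸ H.toSubgroup) ''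
            Set.range (fun j => LinGroup.exp (ηt j))) *
          T₀ ^ H.addDim * T₁ ^ H.torusDim ≤
        (d₀ + d₁).factorial / d₀.factorial * T₀ ^ d₀ * T₁ ^ d₁)
    (h41 : ∀ (d₀ d₁ : ℕ) (p : Place K) (τ : p.ring →+* ℂ), p.IsReduction τ →
      ∀ (Kt : IntermediateField ℚ ℂ) [FiniteDimensional ℚ Kt], (∀ x, τ x ∈ Kt) → Module.finrank ℚ Kt = p.deg →
      ∀ (ℓ₀ : ℕ) (N : Type) [Fintype N] (T₁ : ℕ) (w : Fin ℓ₀ → (Fin d₀ → ℂ) × (Fin d₁ → ℂ))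
        (hw : ∀ j, (∀ i, (w j).1 i ∈ K) ∧ ∀ i, (w j).2 i ∈ K), LinearIndependent K w →
      ∀ (γ : N → LinGroup d₀ d₁)
        (hγ : ∀ j, (∀ i, Multiplicative.toAdd (γ j).1 i ∈ K) ∧ ∀ i, ((γ j).2 i : ℂ) ∈ K)
        (H : LinGroup.ConnAlgSubgroup d₀ d₁), LiePresentation.IsKRational Kt H.addPart →
      (∃ F : Set (MvPolynomial (Fin d₀ ⊕ Fin d₁) ℂ),
          (∀ P ∈ F, (∀ m, P.coeff m ∈ Kt) ∧ ∀ i : Fin d₁, P.degreeOf (Sum.inr i) ≤ T₁) ∧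
          (∀ g ∈ H.toSubgroup, ∀ P ∈ F, LinGroup.evalAt P g = 0) ∧
          ∀ H' : LinGroup.ConnAlgSubgroup d₀ d₁, H.toSubgroup ≤ H'.toSubgroup →
            (∀ g ∈ H'.toSubgroup, ∀ P ∈ F, LinGroup.evalAt P g = 0) → H'.toSubgroup = H.toSubgroup) →
      (∀ j, (∀ i, (⟨(w j).1 i, (hw j).1 i⟩ : K) ∈ p.ring) ∧ ∀ i, (⟨(w j).2 i, (hw j).2 i⟩ : K) ∈ p.ring) →
      (∀ j, (∀ i, (⟨Multiplicative.toAdd (γ j).1 i, (hγ j).1 i⟩ : K) ∈ p.ring) ∧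
        ∀ i, (⟨((γ j).2 i : ℂ), (hγ j).2 i⟩ : K) ∈ p.ring ∧ (⟨((γ j).2 i : ℂ)⁻¹, inv_mem ((hγ j).2 i)⟩ : K) ∈ p.ring) →
      ∀ (wt : Fin ℓ₀ → (Fin d₀ → ℂ) × (Fin d₁ → ℂ)) (γt : N → LinGroup d₀ d₁),
      (∀ j, (∀ i (h : (⟨(w j).1 i, (hw j).1 i⟩ : K) ∈ p.ring), (wt j).1 i = τ ⟨_, h⟩) ∧
        ∀ i (h : (⟨(w j).2 i, (hw j).2 i⟩ : K) ∈ p.ring), (wt j).2 i = τ ⟨_, h⟩) →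
      (∀ j, (∀ i (h : (⟨Multiplicative.toAdd (γ j).1 i, (hγ j).1 i⟩ : K) ∈ p.ring),
          Multiplicative.toAdd (γt j).1 i = τ ⟨_, h⟩) ∧
        ∀ i (h : (⟨((γ j).2 i : ℂ), (hγ j).2 i⟩ : K) ∈ p.ring), ((γt j).2 i : ℂ) = τ ⟨_, h⟩) →
      ∀ (A' : Fin d₁ → ℝ) (B₁ B₂ : ℝ), (∀ i, Real.exp 1 ≤ A' i) → Real.exp 1 ≤ B₁ → Real.exp 1 ≤ B₂ →
      (∀ i : Fin d₀, (ffHeight₁ (fun j : N => (⟨Multiplicative.toAdd (γ j).1 i, (hγ j).1 i⟩ : K)) : ℝ) ≤ Real.log B₁) →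
      (∀ j, (ffHeight₁ (Sum.elim (fun i => (⟨(w j).1 i, (hw j).1 i⟩ : K)) (fun i => (⟨(w j).2 i, (hw j).2 i⟩ : K))) : ℝ)
        ≤ Real.log B₂) →
      (∀ (i : Fin d₁) (j : N), (ffHeight₁ (fun _ : Unit => (⟨((γ j).2 i : ℂ), (hγ j).2 i⟩ : K)) : ℝ) ≤ Real.log (A' i)) →
      max (2 * (d₁ : ℝ) * ((T₁ : ℝ) * ∑ i, Real.log (A' i))) (2 * (d₀ : ℝ) * Real.log B₁ + ℓ₀ * Real.log B₂) < p.deg →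
      ∃ L : LinGroup.ConnAlgSubgroup d₀ d₁,
        LiePresentation.IsKRational K L.addPart ∧ L.addDim = H.addDim ∧ L.torusDim = H.torusDim ∧
        Set.ncard ((QuotientGroup.mk : LinGroup d₀ d₁ → LinGroup d₀ d₁ ⧸ L.toSubgroup) '' Set.range γ) ≤
          Set.ncard ((QuotientGroup.mk : LinGroup d₀ d₁ → LinGroup d₀ d₁ ⧸ H.toSubgroup) '' Set.range γt) ∧
        Module.finrank K ↥(Submodule.span K (Set.range w)) -
            Module.finrank K ↥(Submodule.span K (Set.range w) ⊓ (L.tangent.restrictScalars K)) ≤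
          Module.finrank Kt ↥(Submodule.span Kt (Set.range wt)) -
            Module.finrank Kt ↥(Submodule.span Kt (Set.range wt) ⊓ (H.tangent.restrictScalars Kt)))
    [IsAlgFunctionField ℚ K] (X : RWObj K) (hd₀n : X.d₀ ≤ X.nn) (hd₁ : 0 < X.d₁)
    -- the adapted basis of `Y` and the `K`-basis of `W`
    {a c : ℕ} (η : Fin a ⊕ Fin c → (Fin X.d₀ → ℂ) × (Fin X.d₁ → ℂ)) (hηli : LinearIndependent ℤ η)
    (hηY : Submodule.span ℤ (Set.range η) = X.Y)
    (hηA : Submodule.span ℤ (Set.range (η ∘ Sum.inl)) = X.YaSat) (ha : a = Module.finrank ℤ X.YaSat)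
    (hac : a + c = X.ell₁) (hY2 : ∃ m, (η m).2 ≠ 0)
    (w : Fin X.ell₀ → (Fin X.d₀ → ℂ) × (Fin X.d₁ → ℂ))
    (hw : ∀ j, (∀ i, (w j).1 i ∈ K) ∧ ∀ i, (w j).2 i ∈ K) (hwli : LinearIndependent K w)
    (hwW : Submodule.span K (Set.range w) = X.W)
    (hwC : Submodule.span ℂ (Set.range w) = Submodule.span ℂ (X.W : Set ((Fin X.d₀ → ℂ) × (Fin X.d₁ → ℂ))))
    -- the coordinates of the `η_m` and `γ_m = exp_G(η_m)` as elements of `K`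
    (η1 : Fin a ⊕ Fin c → Fin X.d₀ → K) (hη1 : ∀ m i, (η1 m i : ℂ) = (η m).1 i)
    (γK : Fin a ⊕ Fin c → Fin X.d₁ → K) (hγK : ∀ m i, (γK m i : ℂ) = cexp ((η m).2 i))
    (hγalg : ∀ (m : Fin a) (i : Fin X.d₁), IsAlgebraic ℚ (γK (Sum.inl m) i))
    -- constants
    {c₃₁ κ : ℝ} (hc₃₁ : 0 < c₃₁) (hκ1 : 1 ≤ κ) {D : ℕ}
    {Cγ : ℝ} (hCγ0 : 0 ≤ Cγ)
    (hCγ : ∀ (m : Fin a) (i : Fin X.d₁) (F : IntermediateField ℚ ℂ) [FiniteDimensional ℚ F],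
      (γK (Sum.inl m) i : ℂ) ∈ F → weilHeight₁ F (fun _ : Unit => (γK (Sum.inl m) i : ℂ)) ≤ Cγ)
    {Hff : ℕ} (hHff1 : ffHeight₁ (fun mi : (Fin a ⊕ Fin c) × Fin X.d₀ => η1 mi.1 mi.2) ≤ Hff)
    (hHff2 : ∀ m i, ffHeight₁ (fun _ : Unit => γK m i) ≤ Hff)
    (hHff3 : ∀ j, ffHeight₁ (Sum.elim (fun i => (⟨(w j).1 i, (hw j).1 i⟩ : K))
      (fun i => (⟨(w j).2 i, (hw j).2 i⟩ : K))) ≤ Hff)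
    {Cη : ℝ} (hCη0 : 0 ≤ Cη) (hCη : ∀ m, ‖η m‖ ≤ Cη)
    -- the place, its reduction map and residue field (Théorème 3.1)
    (p : Place K) (τ : p.ring →+* ℂ) (hτ : p.IsReduction τ) (Kt : IntermediateField ℚ ℂ)
    [FiniteDimensional ℚ Kt] (hτKt : ∀ x, τ x ∈ Kt) (hKtD : Module.finrank ℚ Kt = D) (hpD : p.deg = D)
    (hη1r : ∀ m i, η1 m i ∈ p.ring) (hγr : ∀ m i, γK m i ∈ p.ring)
    (hwr : ∀ j, (∀ i, (⟨(w j).1 i, (hw j).1 i⟩ : K) ∈ p.ring) ∧ ∀ i, (⟨(w j).2 i, (hw j).2 i⟩ : K) ∈ p.ring)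
    (hhη1 : ∀ i, weilHeight₁ Kt (fun m => τ ⟨η1 m i, hη1r m i⟩) ≤ κ)
    (hhγ : ∀ m i, weilHeight₁ Kt (fun _ : Unit => τ ⟨γK m i, hγr m i⟩) ≤ κ)
    (hhw : ∀ j, weilHeight₁ Kt (Sum.elim (fun i => τ ⟨_, (hwr j).1 i⟩) (fun i => τ ⟨_, (hwr j).2 i⟩) :
      Fin X.d₀ ⊕ Fin X.d₁ → ℂ) ≤ κ)
    (haη1 : ∀ m i, ‖(η1 m i : ℂ) - τ ⟨η1 m i, hη1r m i⟩‖ ≤ Real.exp (-(κ * (D : ℝ) ^ 2 / c₃₁)))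
    (haγ : ∀ m i, ‖(γK m i : ℂ) - τ ⟨γK m i, hγr m i⟩‖ ≤ Real.exp (-(κ * (D : ℝ) ^ 2 / c₃₁)))
    (haw : ∀ j, (∀ i, ‖(w j).1 i - τ ⟨_, (hwr j).1 i⟩‖ ≤ Real.exp (-(κ * (D : ℝ) ^ 2 / c₃₁))) ∧
      ∀ i, ‖(w j).2 i - τ ⟨_, (hwr j).2 i⟩‖ ≤ Real.exp (-(κ * (D : ℝ) ^ 2 / c₃₁)))
    (hfix : ∀ (m : Fin a) (i : Fin X.d₁), τ ⟨γK (Sum.inl m) i, hγr _ i⟩ = γK (Sum.inl m) i)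
    -- the numerical facts (`…Sec5Numerics.lean`, `Sec5.param_bounds`) at `κ`, `D`
    (hpb : κ ≤ Real.log D ∧ 3 ≤ Real.log κ ∧ Real.log κ ≤ κ ∧ 3 ≤ Real.log (D : ℝ) ∧
      (1 ≤ Sec5.T0 κ D ∧ (Sec5.T0 κ D : ℝ) ≤ κ * D / (Real.log κ * Real.log D) ∧
        κ * D / (Real.log κ * Real.log D) ≤ 2 * Sec5.T0 κ D) ∧
      (1 ≤ Sec5.T1 X.d₀ X.d₁ X.nn κ D ∧ 2 * Real.log κ ^ 2 * Sec5.T1 X.d₀ X.d₁ X.nn κ D ≤ D ∧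
        (D : ℝ) ^ (1 / (X.d₁ : ℝ)) ≤ 2 * Sec5.T1 X.d₀ X.d₁ X.nn κ D ∧
        Sec5.Theta X.d₀ X.d₁ X.nn κ D ≤ ((Sec5.T1 X.d₀ X.d₁ X.nn κ D : ℝ) + 1) ^ X.d₁ ∧
        (Sec5.T1 X.d₀ X.d₁ X.nn κ D : ℝ) ^ X.d₁ ≤ Sec5.Theta X.d₀ X.d₁ X.nn κ D) ∧
      (1 ≤ Sec5.S2 X.d₀ X.d₁ X.nn κ D ∧ Sec5.S2 X.d₀ X.d₁ X.nn κ D ≤ Sec5.S1 X.d₀ X.d₁ X.nn κ D ∧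
        Real.log κ ^ 2 * Sec5.T1 X.d₀ X.d₁ X.nn κ D * Sec5.S1 X.d₀ X.d₁ X.nn κ D ≤ κ * D ∧
        Real.log κ ^ 2 * Sec5.T1 X.d₀ X.d₁ X.nn κ D * Sec5.S2 X.d₀ X.d₁ X.nn κ D ≤ D ∧
        (D : ℝ) ≤ 2 * (Real.log κ ^ 2 * Sec5.T1 X.d₀ X.d₁ X.nn κ D * Sec5.S2 X.d₀ X.d₁ X.nn κ D)))
    -- largeness of `log κ`
    (hkU : 4 * c₃₁ * (12 * ((X.d₀ : ℝ) + X.d₁) + 13) * X.d₁ ≤ Real.log κ)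
    (hkd₁ : (X.d₁ : ℝ) ≤ Real.log κ)
    (hkA : (a : ℝ) * Cγ + c ≤ Real.log κ) (hkη : ((a : ℝ) + c) * (Cη + 1) ≤ Real.log κ)
    (hkH : (c : ℝ) * Hff ≤ Real.log κ) (hk41 : 2 * (X.d₁ : ℝ) ^ 2 < Real.log κ)
    (hkV : 4 * 2 ^ X.d₀ * (X.d₀.factorial : ℝ) ≤ Real.log κ ^ X.d₁ * (4 * c₃₁) ^ X.nn)
    -- largeness of `D`
    (hLB : 2 * (((X.d₀ : ℝ) + X.d₁) + 1) * κ ≤ Real.log D)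
    (hLe : 2 * (8 * c₃₁ * (12 * ((X.d₀ : ℝ) + X.d₁) + 13) * (((X.d₀ : ℝ) + X.d₁) + 1)) ≤ Real.log D)
    (hL41 : 2 * (2 * (X.d₀ : ℝ) + X.ell₀ + 1) ≤ Real.log D)
    (hLadd : (X.d₁ : ℝ) * (Real.log (2 * ((a : ℝ) + c) * κ) + κ) ≤ Real.log D)
    (hLH : (Hff : ℝ) + 1 ≤ Real.log D)
    (hDt : 2 * ((a : ℝ) + c) * Real.exp Cη * c₃₁ ≤ D) (hDt' : c₃₁ * (Real.log 2 + Cη) ≤ D) :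
    ∃ L : LinGroup.ConnAlgSubgroup X.d₀ X.d₁, LiePresentation.IsKRational K L.addPart ∧ L.tangent ≠ ⊤ ∧
      Sec5.T0 κ D ^ (X.ell₀ - Module.finrank K ↥(X.W ⊓ L.tangent.restrictScalars K)) *
        Sec5.S1 X.d₀ X.d₁ X.nn κ D ^ (Module.finrank ℤ X.YaSat -
          Module.finrank ℤ ↥(X.YaSat ⊓ (L.tangent.restrictScalars ℤ ⊔ omegaLattice X.d₀ X.d₁))) *
        Sec5.S2 X.d₀ X.d₁ X.nn κ D ^ ((X.ell₁ -
          Module.finrank ℤ ↥(X.Y ⊓ (L.tangent.restrictScalars ℤ ⊔ omegaLattice X.d₀ X.d₁))) -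
          (Module.finrank ℤ X.YaSat -
            Module.finrank ℤ ↥(X.YaSat ⊓ (L.tangent.restrictScalars ℤ ⊔ omegaLattice X.d₀ X.d₁)))) ≤
      (X.d₀ + X.d₁).factorial / X.d₀.factorial * Sec5.T0 κ D ^ (X.d₀ - L.addDim) *
        Sec5.T1 X.d₀ X.d₁ X.nn κ D ^ (X.d₁ - L.torusDim) := by
  classical
  obtain ⟨hκL, hk3, hkκ, hLg3, ⟨hT0₁, hT0le, hT0ge⟩, ⟨hT1₁, hT1D, hDT1, hΘle, -⟩,
    ⟨hS2₁, hS21, hS1le, hS2le, -⟩⟩ := hpb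
  /- ## abbreviations and elementary facts -/
  set T0 : ℕ := Sec5.T0 κ D with hT0def
  set T1 : ℕ := Sec5.T1 X.d₀ X.d₁ X.nn κ D with hT1def
  set S1 : ℕ := Sec5.S1 X.d₀ X.d₁ X.nn κ D with hS1def
  set S2 : ℕ := Sec5.S2 X.d₀ X.d₁ X.nn κ D with hS2def
  set k : ℝ := Real.log κ with hkdef
  set Lg : ℝ := Real.log D with hLgdef
  have hk0 : 0 < k := by linarith only [hk3]
  have hk1 : 1 ≤ k := by linarith only [hk3]
  have hκ0 : 0 < κ := by linarith only [hκ1]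
  have hLg0 : 0 < Lg := by linarith only [hLg3]
  have hDnat : 0 < D := by
    rcases Nat.eq_zero_or_pos D with h | h
    · exfalso
      have : Lg = 0 := by rw [hLgdef, h]; simp
      linarith only [hLg3, this]
    · exact h
  have hD0 : (0 : ℝ) < D := by exact_mod_cast hDnat
  have hLgD : Lg ≤ D := by rw [hLgdef]; exact (Real.log_le_sub_one_of_pos hD0).trans (sub_le_self _ zero_le_one)
  have hD3 : Real.exp 3 ≤ D := by
    rw [← Real.exp_log hD0]; exact Real.exp_le_exp.mpr hLg3
  have he3 : (3 : ℝ) < Real.exp 3 := by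
    have := Real.add_one_lt_exp (by norm_num : (3 : ℝ) ≠ 0); linarith only [this]
  have hDe : Real.exp 1 ≤ D := le_trans (Real.exp_le_exp.mpr (by norm_num)) hD3
  have hD1 : (1 : ℝ) < D := lt_of_lt_of_le (by have := Real.exp_one_gt_d9; linarith only [this]) hDe
  have hD2 : (2 : ℝ) ≤ D := by linarith only [hD3, he3]
  have hT0R : (1 : ℝ) ≤ T0 := by exact_mod_cast hT0₁
  have hT1R : (1 : ℝ) ≤ T1 := by exact_mod_cast hT1₁
  have hS2R : (1 : ℝ) ≤ S2 := by exact_mod_cast hS2₁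
  have hS21R : (S2 : ℝ) ≤ S1 := by exact_mod_cast hS21
  have hS1R : (1 : ℝ) ≤ S1 := hS2R.trans hS21R
  have hT0pos : (0 : ℝ) < T0 := by linarith only [hT0R]
  have hT1pos : (0 : ℝ) < T1 := by linarith only [hT1R]
  have hS1pos : (0 : ℝ) < S1 := by linarith only [hS1R]
  have hd₁1 : (1 : ℝ) ≤ X.d₁ := by exact_mod_cast hd₁
  have hd₀0 : (0 : ℝ) ≤ X.d₀ := Nat.cast_nonneg _
  have hdR1 : (1 : ℝ) ≤ (X.d₀ : ℝ) + X.d₁ := by linarith only [hd₀0, hd₁1]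
  have hdR0 : (0 : ℝ) ≤ (X.d₀ : ℝ) + X.d₁ := by linarith only [hdR1]
  -- `a + c ≥ 1`
  have hac1 : 1 ≤ a + c := by
    obtain ⟨m, -⟩ := hY2
    have : 0 < Fintype.card (Fin a ⊕ Fin c) := Fintype.card_pos_iff.mpr ⟨m⟩
    simp only [Fintype.card_sum, Fintype.card_fin] at this
    omega
  have hac1R : (1 : ℝ) ≤ (a : ℝ) + c := by exact_mod_cast hac1
  /- ## the box `Σ` -/
  set S : Fin a ⊕ Fin c → ℕ := fun m => Sum.elim (fun _ : Fin a => S1) (fun _ : Fin c => S2) m with hSdef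
  have hSinl : ∀ m : Fin a, S (Sum.inl m) = S1 := fun m => rfl
  have hSinr : ∀ m : Fin c, S (Sum.inr m) = S2 := fun m => rfl
  have hS1m : ∀ m, 1 ≤ S m := by
    rintro (m | m)
    · rw [hSinl]; exact hS2₁.trans hS21
    · rw [hSinr]; exact hS2₁
  have hSle : ∀ m, S m ≤ S1 := by
    rintro (m | m)
    · rw [hSinl]
    · rw [hSinr]; exact hS21
  have hsle : ∀ (s : ∀ m, Fin (S m + 1)) m, (s m : ℕ) ≤ S m := fun s m => Nat.lt_succ_iff.mp (s m).is_lt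
  have hsumS : ∀ s : ∀ m, Fin (S m + 1), ∑ m, (s m : ℕ) ≤ (a + c) * S1 := by
    intro s
    calc ∑ m, (s m : ℕ) ≤ ∑ _m : Fin a ⊕ Fin c, S1 :=
          Finset.sum_le_sum fun m _ => (hsle s m).trans (hSle m)
      _ = (a + c) * S1 := by simp [Fintype.card_sum]
  have hsumSR : ∀ s : ∀ m, Fin (S m + 1), ∑ m, ((s m : ℕ) : ℝ) ≤ ((a : ℝ) + c) * S1 := by
    intro s; exact_mod_cast hsumS s
  have hsumSmR : ∑ m, (S m : ℝ) ≤ ((a : ℝ) + c) * S1 := by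
    calc ∑ m, (S m : ℝ) ≤ ∑ _m : Fin a ⊕ Fin c, (S1 : ℝ) :=
          Finset.sum_le_sum fun m _ => by exact_mod_cast hSle m
      _ = ((a : ℝ) + c) * S1 := by simp [Fintype.card_sum]
  /- ## the points of `Σ` and their coordinates in `K` -/
  set ηs : (∀ m, Fin (S m + 1)) → (Fin X.d₀ → ℂ) × (Fin X.d₁ → ℂ) := boxFamily η S with hηsdef
  set xs : (∀ m, Fin (S m + 1)) → Fin X.d₀ → K := fun s i => ∑ m, ((s m : ℕ) : K) * η1 m i
    with hxsdef
  set ys : (∀ m, Fin (S m + 1)) → Fin X.d₁ → K := fun s i => ∏ m, γK m i ^ (s m : ℕ) with hysdef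
  have hxs : ∀ s i, ((xs s i : K) : ℂ) = (ηs s).1 i := by
    intro s i
    rw [hηsdef, fst_boxFamily]
    simp only [hxsdef]
    push_cast
    exact Finset.sum_congr rfl fun m _ => by rw [hη1]
  have hys : ∀ s i, ((ys s i : K) : ℂ) = ((LinGroup.exp (ηs s)).2 i : ℂ) := by
    intro s i
    rw [hηsdef, coe_exp_boxFamily_snd]
    simp only [hysdef]
    push_cast
    exact Finset.prod_congr rfl fun m _ => by rw [hγK]
  have hγK0 : ∀ m i, γK m i ≠ 0 := by
    intro m i h0
    have h1 := hγK m i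
    rw [h0] at h1
    exact Complex.exp_ne_zero _ (by exact_mod_cast h1.symm)
  have hηsK : ∀ s i, (ηs s).1 i ∈ K := fun s i => by rw [← hxs]; exact (xs s i).2
  have hγsK : ∀ s, (∀ i, Multiplicative.toAdd ((LinGroup.exp (ηs s)).1) i ∈ K) ∧
      ∀ i, (((LinGroup.exp (ηs s)).2 i : ℂ)) ∈ K := by
    intro s
    refine ⟨fun i => ?_, fun i => ?_⟩
    · rw [LinGroup.toAdd_exp_fst]; exact hηsK s i
    · rw [← hys]; exact (ys s i).2
  -- the corresponding elements of `K` (as subtypes) are `xs`, `ys`, `ys⁻¹`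
  have exs : ∀ s i, (⟨Multiplicative.toAdd ((LinGroup.exp (ηs s)).1) i, (hγsK s).1 i⟩ : K) = xs s i :=
    fun s i => Subtype.ext (by simp only [LinGroup.toAdd_exp_fst]; rw [hxs])
  have eys : ∀ s i, (⟨((LinGroup.exp (ηs s)).2 i : ℂ), (hγsK s).2 i⟩ : K) = ys s i :=
    fun s i => Subtype.ext (by rw [hys])
  have eysi : ∀ s i, (⟨(((LinGroup.exp (ηs s)).2 i : ℂ))⁻¹, inv_mem ((hγsK s).2 i)⟩ : K) = (ys s i)⁻¹ :=
    fun s i => Subtype.ext (by push_cast; rw [hys])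
  -- ring memberships
  have hxsr : ∀ s i, xs s i ∈ p.ring := fun s i =>
    sum_mem fun m _ => mul_mem (p.natCast_mem_ring _) (hη1r m i)
  have hysr : ∀ s i, ys s i ∈ p.ring := fun s i => prod_mem fun m _ => pow_mem (hγr m i) _
  have hHffD : Hff < p.deg := by
    have h1 : (Hff : ℝ) < D := by linarith only [hLH, hLgD]
    rw [hpD]; exact_mod_cast h1
  have hγinv : ∀ m i, (γK m i)⁻¹ ∈ p.ring := fun m i =>
    (p.mem_ring_and_inv_mem_ring (hγK0 m i) (lt_of_le_of_lt (hHff2 m i) hHffD)).2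
  have hysinv : ∀ s i, (ys s i)⁻¹ ∈ p.ring := by
    intro s i
    have : (ys s i)⁻¹ = ∏ m, (γK m i)⁻¹ ^ (s m : ℕ) := by
      simp only [hysdef, ← Finset.prod_inv_distrib, inv_pow]
    rw [this]
    exact prod_mem fun m _ => pow_mem (hγinv m i) _
  -- `τ` on `xs`, `ys`
  have hτxs : ∀ s i, τ ⟨xs s i, hxsr s i⟩ = ∑ m, ((s m : ℕ) : ℂ) * τ ⟨η1 m i, hη1r m i⟩ := by
    intro s i
    have e : (⟨xs s i, hxsr s i⟩ : p.ring) = ∑ m, ((s m : ℕ) : p.ring) * ⟨η1 m i, hη1r m i⟩ :=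
      Subtype.ext (by push_cast; simp only [hxsdef])
    rw [e, map_sum]
    simp only [map_mul, map_natCast]
  have hτys : ∀ s i, τ ⟨ys s i, hysr s i⟩ = ∏ m, τ ⟨γK m i, hγr m i⟩ ^ (s m : ℕ) := by
    intro s i
    have e : (⟨ys s i, hysr s i⟩ : p.ring) = ∏ m, (⟨γK m i, hγr m i⟩ : p.ring) ^ (s m : ℕ) :=
      Subtype.ext (by push_cast; simp only [hysdef])
    rw [e, map_prod]
    simp only [map_pow]
  /- ## the perturbed points `η̃` (p. 782) -/
  set δ₀ : ℝ := Real.exp (-(κ * (D : ℝ) ^ 2 / c₃₁)) with hδ₀def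
  set δ : ℝ := δ₀ * Real.exp Cη with hδdef
  have hδ₀pos : 0 < δ₀ := Real.exp_pos _
  have heCη : 1 ≤ Real.exp Cη := Real.one_le_exp hCη0
  have hδpos : 0 < δ := mul_pos hδ₀pos (by linarith only [heCη])
  have hδ₀δ : δ₀ ≤ δ := le_mul_of_one_le_right hδ₀pos.le heCη
  -- the approximation constraints
  have hS1κD : (S1 : ℝ) ≤ κ * D := by
    have h1 : (1 : ℝ) ≤ k ^ 2 * T1 := one_le_mul_of_one_le_of_one_le (one_le_pow₀ hk1) hT1R
    calc (S1 : ℝ) = 1 * S1 := (one_mul _).symm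
      _ ≤ k ^ 2 * T1 * S1 := mul_le_mul_of_nonneg_right h1 hS1pos.le
      _ ≤ κ * D := hS1le
  obtain ⟨hδV, hMδ, hδc⟩ := Sec5.approx_constraints (c := c₃₁) (κ := κ) (D := (D : ℝ))
    (M := 3 / 2 * ((a : ℝ) + c) * S1 * Real.exp Cη) (cmin := 1 / (2 * Real.exp Cη)) hc₃₁ hκ0 hD0
    (by positivity) (by positivity)
    (by
      -- `(3/2)(a+c) S1 e^{Cη} ≤ 3κD²/(4c₃₁)`
      have h1 : 3 / 2 * ((a : ℝ) + c) * S1 * Real.exp Cη ≤ 3 / 2 * ((a : ℝ) + c) * (κ * D) * Real.exp Cη := by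
        gcongr
      refine h1.trans ?_
      rw [le_div_iff₀ (by positivity)]
      have h2 : 2 * ((a : ℝ) + c) * Real.exp Cη * c₃₁ * (κ * D) ≤ D * (κ * D) :=
        mul_le_mul_of_nonneg_right hDt (by positivity)
      linarith only [h2])
    (by
      rw [one_div, Real.log_inv, neg_neg, Real.log_mul (by norm_num) (Real.exp_pos _).ne', Real.log_exp]
      -- `log 2 + Cη ≤ κ D² / c₃₁`
      rw [le_div_iff₀ hc₃₁]
      have h1 : (D : ℝ) ≤ κ * (D : ℝ) ^ 2 :=
        calc (D : ℝ) = 1 * (1 * D) := by ring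
          _ ≤ κ * (D * D) := mul_le_mul hκ1 (mul_le_mul_of_nonneg_right hD1.le hD0.le) (by positivity) hκ0.le
          _ = κ * (D : ℝ) ^ 2 := by ring
      calc (Real.log 2 + Cη) * c₃₁ = c₃₁ * (Real.log 2 + Cη) := mul_comm _ _
        _ ≤ D := hDt'
        _ ≤ κ * (D : ℝ) ^ 2 := h1)
  have hδhalf : δ ≤ 1 / 2 := by
    rw [hδdef]
    have h1 := mul_le_mul_of_nonneg_right hδc (Real.exp_pos Cη).le
    have e : 1 / (2 * Real.exp Cη) * Real.exp Cη = 1 / 2 := by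
      field_simp
    rw [e] at h1
    exact h1
  have hexpγ : ∀ m i, Real.exp (-Cη) ≤ ‖cexp ((η m).2 i)‖ := by
    intro m i
    rw [Complex.norm_exp]
    apply Real.exp_le_exp.mpr
    have h1 : |((η m).2 i).re| ≤ ‖(η m).2 i‖ := Complex.abs_re_le_norm _
    have h2 : ‖(η m).2 i‖ ≤ ‖(η m).2‖ := norm_le_pi_norm _ i
    have h3 : ‖(η m).2‖ ≤ ‖η m‖ := norm_snd_le _
    have h4 := hCη m
    have h5 := neg_abs_le ((η m).2 i).re
    linarith only [h1, h2, h3, h4, h5]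
  have htilde : ∀ m, ∃ ηt : (Fin X.d₀ → ℂ) × (Fin X.d₁ → ℂ),
      ηt.1 = (fun i => τ ⟨η1 m i, hη1r m i⟩) ∧ (∀ i, cexp (ηt.2 i) = τ ⟨γK m i, hγr m i⟩) ∧
      ‖η m - ηt‖ ≤ 3 / 2 * δ := by
    intro m
    refine exists_tilde (η m) _ _ hδpos.le hδhalf (fun i => ?_) (fun i => ?_)
    · rw [← hη1 m i]; exact (haη1 m i).trans hδ₀δ
    · rw [norm_sub_rev, ← hγK m i]
      calc ‖(γK m i : ℂ) - τ ⟨γK m i, hγr m i⟩‖ ≤ δ₀ := haγ m i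
        _ = δ * Real.exp (-Cη) := by
            rw [hδdef, mul_assoc, ← Real.exp_add, add_neg_cancel, Real.exp_zero, mul_one]
        _ ≤ δ * ‖cexp ((η m).2 i)‖ := mul_le_mul_of_nonneg_left (hexpγ m i) hδpos.le
        _ = δ * ‖(γK m i : ℂ)‖ := by rw [hγK]
  choose ηt hηt1 hηt2 hηt3 using htilde
  set ηts : (∀ m, Fin (S m + 1)) → (Fin X.d₀ → ℂ) × (Fin X.d₁ → ℂ) := boxFamily ηt S with hηtsdef
  set wt : Fin X.ell₀ → (Fin X.d₀ → ℂ) × (Fin X.d₁ → ℂ) :=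
    fun j => (fun i => τ ⟨_, (hwr j).1 i⟩, fun i => τ ⟨_, (hwr j).2 i⟩) with hwtdef
  have hηts1 : ∀ s i, (ηts s).1 i = ∑ m, ((s m : ℕ) : ℂ) * τ ⟨η1 m i, hη1r m i⟩ := by
    intro s i
    rw [hηtsdef, fst_boxFamily]
    exact Finset.sum_congr rfl fun m _ => by rw [hηt1]
  have hηts2 : ∀ s i, cexp ((ηts s).2 i) = ∏ m, τ ⟨γK m i, hγr m i⟩ ^ (s m : ℕ) := by
    intro s i
    rw [hηtsdef, exp_snd_boxFamily]
    exact Finset.prod_congr rfl fun m _ => by rw [hηt2]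
  have hηts1τ : ∀ s i, (ηts s).1 i = τ ⟨xs s i, hxsr s i⟩ := fun s i => by rw [hηts1, hτxs]
  have hηts2τ : ∀ s i, cexp ((ηts s).2 i) = τ ⟨ys s i, hysr s i⟩ := fun s i => by rw [hηts2, hτys]
  have hwtKt : ∀ j, (∀ i, (wt j).1 i ∈ Kt) ∧ ∀ i, (wt j).2 i ∈ Kt :=
    fun j => ⟨fun i => hτKt _, fun i => hτKt _⟩
  have hηtsKt : ∀ s, (∀ i, (ηts s).1 i ∈ Kt) ∧ ∀ i, cexp ((ηts s).2 i) ∈ Kt :=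
    fun s => ⟨fun i => by rw [hηts1τ]; exact hτKt _, fun i => by rw [hηts2τ]; exact hτKt _⟩
  have hone : ∃ s, LinGroup.exp (ηts s) = 1 := ⟨fun _ => 0, by rw [hηtsdef]; exact exp_boxFamily_zero ηt S⟩
  have hne : ∃ s, (ηs s).2 ≠ 0 := by
    obtain ⟨m, hm⟩ := hY2
    refine ⟨fun l => if l = m then ⟨1, by have := hS1m l; omega⟩ else 0, ?_⟩
    rw [hηsdef, boxFamily_single η S hS1m m]
    exact hm
  -- sizes of the perturbations
  have hηtn : ∀ m i, ‖(ηt m).2 i‖ ≤ Cη + 1 := by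
    intro m i
    have h1 : ‖(ηt m).2 i‖ ≤ ‖ηt m‖ := (norm_le_pi_norm _ i).trans (norm_snd_le _)
    have h2 : ‖ηt m‖ ≤ ‖η m‖ + ‖η m - ηt m‖ := by
      have := norm_sub_norm_le (ηt m) (η m); rw [norm_sub_rev] at this; linarith only [this]
    have h3 := hηt3 m
    have h4 := hCη m
    linarith only [h1, h2, h3, h4, hδhalf]
  have hηts2n : ∀ s i, ‖(ηts s).2 i‖ ≤ ((a : ℝ) + c) * S1 * (Cη + 1) := by
    intro s i
    rw [hηtsdef, snd_boxFamily]
    calc ‖∑ m, ((s m : ℕ) : ℂ) * (ηt m).2 i‖ ≤ ∑ m, ‖((s m : ℕ) : ℂ) * (ηt m).2 i‖ := norm_sum_le _ _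
      _ ≤ ∑ m, ((s m : ℕ) : ℝ) * (Cη + 1) := Finset.sum_le_sum fun m _ => by
          rw [norm_mul, Complex.norm_natCast]
          exact mul_le_mul_of_nonneg_left (hηtn m i) (Nat.cast_nonneg _)
      _ = (∑ m, ((s m : ℕ) : ℝ)) * (Cη + 1) := (Finset.sum_mul _ _ _).symm
      _ ≤ ((a : ℝ) + c) * S1 * (Cη + 1) := mul_le_mul_of_nonneg_right (hsumSR s) (by linarith only [hCη0])
  set V : ℝ := κ * (D : ℝ) ^ 2 / (4 * c₃₁) with hVdef
  have hVpos : 0 < V := by positivity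
  have haw' : ∀ j, ‖w j - wt j‖ ≤ Real.exp (-V) := by
    intro j
    rw [Prod.norm_def, max_le_iff]
    refine ⟨(pi_norm_le_iff_of_nonneg (Real.exp_pos _).le).mpr fun i => ?_,
      (pi_norm_le_iff_of_nonneg (Real.exp_pos _).le).mpr fun i => ?_⟩
    · exact ((haw j).1 i).trans hδV
    · exact ((haw j).2 i).trans hδV
  have haη' : ∀ s, ‖ηs s - ηts s‖ ≤ Real.exp (-V) := by
    intro s
    rw [hηsdef, hηtsdef]
    refine (norm_boxFamily_sub_le η ηt S s hηt3).trans ?_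
    calc (∑ m, (S m : ℝ)) * (3 / 2 * δ) ≤ ((a : ℝ) + c) * S1 * (3 / 2 * δ) :=
          mul_le_mul_of_nonneg_right hsumSmR (by positivity)
      _ = 3 / 2 * ((a : ℝ) + c) * S1 * Real.exp Cη * δ₀ := by rw [hδdef]; ring
      _ ≤ Real.exp (-V) := hMδ
  /- ## the numerical hypotheses of Théorème 2.1 -/
  set U : ℝ := V / (12 * ((X.d₀ : ℝ) + X.d₁) + 13) with hUdef
  have hUpos : 0 < U := by positivity
  set Λ : ℝ := κ * D / (T1 * k) with hΛdef
  obtain ⟨hΛ1, hΛ2, hΛ3, hΛ4⟩ := Sec5.logA_constraints (κ := κ) (k := k) (D := (D : ℝ)) (T1 := (T1 : ℝ))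
    (S1 := (S1 : ℝ)) (S2 := (S2 : ℝ)) (Ca := (a : ℝ) * Cγ) (Cℓ := (c : ℝ)) (Cη := ((a : ℝ) + c) * (Cη + 1))
    hk3 hkκ hD2 hT1R (by positivity) (by positivity) (by positivity) hS1le hS2le hT1D hkA hkη
  obtain ⟨hU1, hU2⟩ := Sec5.U_constraints (c := c₃₁) (d := (X.d₀ : ℝ) + X.d₁) (d₁ := (X.d₁ : ℝ)) (κ := κ) (k := k)
    (L := Lg) (D := (D : ℝ)) (T0 := (T0 : ℝ)) (T1 := (T1 : ℝ)) hc₃₁ hdR1 hd₁1 hκ0 hk0 hLg0 hD0 hT1pos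
    hT0le hkU
  have hB2 : ((X.d₀ : ℝ) + X.d₁) * T0 + T0 + X.d₁ * T1 ≤ (D : ℝ) :=
    Sec5.B₂_constraint (d := (X.d₀ : ℝ) + X.d₁) (d₁ := (X.d₁ : ℝ)) hdR0 (by positivity) hκ0 hk3 hkd₁ hLB hD0 hT0le hT1D
  have hT0d₀ : (T0 : ℝ) + X.d₀ ≤ D := by
    have h1 : (X.d₀ : ℝ) ≤ ((X.d₀ : ℝ) + X.d₁) * T0 := by
      calc (X.d₀ : ℝ) ≤ (X.d₀ : ℝ) + X.d₁ := by linarith only [(Nat.cast_nonneg X.d₁ : (0:ℝ) ≤ X.d₁)]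
        _ = ((X.d₀ : ℝ) + X.d₁) * 1 := (mul_one _).symm
        _ ≤ ((X.d₀ : ℝ) + X.d₁) * T0 := mul_le_mul_of_nonneg_left hT0R hdR0
    have h2 : (0 : ℝ) ≤ X.d₁ * T1 := by positivity
    linarith only [h1, h2, hB2]
  have hT1one : (T1 : ℝ) + 1 ≤ D := by
    have h1 : (T1 : ℝ) ≤ X.d₁ * T1 := le_mul_of_one_le_left hT1pos.le hd₁1
    have h2 : (0 : ℝ) ≤ ((X.d₀ : ℝ) + X.d₁) * T0 := by positivity
    linarith only [h1, h2, hB2, hT0R]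
  have hbigE : 8 * c₃₁ * (12 * ((X.d₀ : ℝ) + X.d₁) + 13) * (((X.d₀ : ℝ) + X.d₁) + 1) * Real.log D ≤ D := by
    have h := Sec5.mul_le_exp_of_ge (M := 8 * c₃₁ * (12 * ((X.d₀ : ℝ) + X.d₁) + 13) * (((X.d₀ : ℝ) + X.d₁) + 1))
      (L := Lg) (by positivity) hLe
    rwa [hLgdef, Real.exp_log hD0] at h
  have hexpC := Sec5.exp_constraint (c := c₃₁) (κ := κ) (D := (D : ℝ)) (d₀ := X.d₀) (d₁ := X.d₁) (T0 := T0)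
    (T1 := T1) hc₃₁ hκ1 hLg3 hD0 hT0d₀ hT1one hbigE
  have hΘle' : k ^ (X.d₀ + X.d₁) * κ ^ (X.nn - X.d₀) * (D : ℝ) ^ (2 * X.nn - X.d₀) / Lg ^ (X.nn - X.d₀) ≤
      ((T1 : ℝ) + 1) ^ X.d₁ := hΘle
  have hVC := Sec5.V_constraint (c := c₃₁) (κ := κ) (D := (D : ℝ)) (k := k) (L := Lg) (d₀ := X.d₀) (d₁ := X.d₁)
    (n := X.nn) (T0 := T0) (T1 := T1) hc₃₁ hκ0 hD0 hk0 hLg0 hd₀n hT0ge hΘle' hkV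
  have hadd : Real.log (((a : ℝ) + c) * S1) + κ ≤ Real.log D :=
    Sec5.additive_height_constraint (d₁ := X.d₁) hd₁ hκ1 hk1 hD1 hT1pos hS1pos hac1R hS1le hDT1 hLadd
  have h2d : 2 * ((X.d₀ : ℝ) + X.d₁) ≤ D := by
    have h1 : 2 * (((X.d₀ : ℝ) + X.d₁) + 1) * 1 ≤ 2 * (((X.d₀ : ℝ) + X.d₁) + 1) * κ :=
      mul_le_mul_of_nonneg_left hκ1 (by positivity)
    linarith only [h1, hLB, hLgD]
  have hdD : ((X.d₀ : ℝ) + X.d₁) ≤ D := by linarith only [h2d, hdR0]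
  -- (H1) heights of the additive coordinates of the `η̃_s`
  have hH1 : ∀ i : Fin X.d₀, weilHeight₁ Kt (fun s => (ηts s).1 i) ≤ Real.log D := by
    intro i
    have e : (fun s => (ηts s).1 i) = fun s : ∀ m, Fin (S m + 1) => ∑ m, (((fun s m => (s m : ℕ)) s m : ℕ) : ℂ) *
        (fun m => τ ⟨η1 m i, hη1r m i⟩) m := funext fun s => hηts1 s i
    rw [e]
    have h1 := weilHeight₁_linearComb_le Kt (fun m => τ ⟨η1 m i, hη1r m i⟩) (fun m => hτKt _)
      (fun (s : ∀ m, Fin (S m + 1)) m => (s m : ℕ)) (S := (a + c) * S1)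
      (Nat.one_le_iff_ne_zero.mpr (Nat.mul_ne_zero (by omega) (by omega))) hsumS
    refine h1.trans ?_
    have h2 := hhη1 i
    push_cast at h1 ⊢
    linarith only [h1, h2, hadd]
  -- (H2) heights of the `w̃_j`
  have hH2 : ∀ j, weilHeight₁ Kt (Sum.elim (wt j).1 (wt j).2 : Fin X.d₀ ⊕ Fin X.d₁ → ℂ) ≤ Real.log D :=
    fun j => (hhw j).trans hκL
  -- (H3) the multiplicative coordinates
  have hfixh : ∀ (m : Fin a) i, weilHeight₁ Kt (fun _ : Unit => τ ⟨γK (Sum.inl m) i, hγr _ i⟩) ≤ Cγ := by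
    intro m i
    rw [hfix]
    exact hCγ m i Kt (by rw [← hfix m i]; exact hτKt _)
  have hH3 : ∀ (i : Fin X.d₁) (s : ∀ m, Fin (S m + 1)),
      weilHeight₁ Kt (fun _ : Unit => cexp ((ηts s).2 i)) ≤ Real.log (Real.exp Λ) ∧
      2 / (Module.finrank ℚ Kt : ℝ) ≤ Real.log (Real.exp Λ) ∧
      (D : ℝ) / (Module.finrank ℚ Kt : ℝ) * ‖(ηts s).2 i‖ ≤ Real.log (Real.exp Λ) := by
    intro i s
    rw [Real.log_exp, hKtD]
    refine ⟨?_, hΛ3, ?_⟩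
    · rw [hηts2]
      have h1 := weilHeight₁_prod_pow_le Kt (fun m => τ ⟨γK m i, hγr m i⟩) (fun m => hτKt _)
        (fun m => (s m : ℕ))
      refine h1.trans ?_
      rw [Fintype.sum_sum_type]
      have ha' : ∑ m : Fin a, ((s (Sum.inl m) : ℕ) : ℝ) * weilHeight₁ Kt (fun _ : Unit => τ ⟨γK (Sum.inl m) i, hγr _ i⟩) ≤
          ∑ _m : Fin a, (S1 : ℝ) * Cγ := Finset.sum_le_sum fun m _ =>
        mul_le_mul (by exact_mod_cast (hsle s (Sum.inl m)).trans (hSle _)) (hfixh m i)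
          (weilHeight₁_nonneg Kt _) (Nat.cast_nonneg _)
      have hc' : ∑ m : Fin c, ((s (Sum.inr m) : ℕ) : ℝ) * weilHeight₁ Kt (fun _ : Unit => τ ⟨γK (Sum.inr m) i, hγr _ i⟩) ≤
          ∑ _m : Fin c, (S2 : ℝ) * κ := Finset.sum_le_sum fun m _ =>
        mul_le_mul (by exact_mod_cast (hsle s (Sum.inr m))) (hhγ _ i)
          (weilHeight₁_nonneg Kt _) (Nat.cast_nonneg _)
      simp only [Finset.sum_const, Finset.card_univ, Fintype.card_fin, nsmul_eq_mul] at ha' hc'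
      calc _ ≤ (a : ℝ) * (S1 * Cγ) + c * (S2 * κ) := add_le_add ha' hc'
        _ = S1 * (a * Cγ) + S2 * c * κ := by ring
        _ ≤ Λ := hΛ1
    · rw [div_self hD0.ne', one_mul]
      exact (hηts2n s i).trans (le_of_eq_of_le (by ring) hΛ2)
  have hU1' : (Module.finrank ℚ Kt : ℝ) * (T0 * Real.log D) ≤ U := by rw [hKtD]; exact hU1
  have hU2' : (Module.finrank ℚ Kt : ℝ) * (T1 * ∑ _i : Fin X.d₁, Real.log (Real.exp Λ)) ≤ U := by
    rw [hKtD]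
    simp only [Real.log_exp, Finset.sum_const, Finset.card_univ, Fintype.card_fin, nsmul_eq_mul]
    exact hU2
  have hUV : (12 * ((X.d₀ : ℝ) + X.d₁) + 13) * U ≤ V := by
    rw [hUdef, mul_div_cancel₀ _ (by positivity)]
  have hlogE : Real.log D ≤ (Module.finrank ℚ Kt : ℝ) * Real.log D := by
    rw [hKtD]; exact le_mul_of_one_le_left hLg0.le hD1.le
  have hB2' : ((X.d₀ : ℝ) + X.d₁) * T0 + T0 + X.d₁ * T1 ≤ D := hB2
  have hexpC' : ((Nat.choose (T0 + X.d₀) X.d₀ : ℝ) * ((T1 : ℝ) + 1) ^ X.d₁ ≤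
      1 / 8 * Real.exp (U / (2 * Module.finrank ℚ Kt))) := by
    rw [hKtD]; exact hexpC
  have hVC' : 4 * (V / Real.log D) ^ (Module.finrank ℂ (Submodule.span ℂ (Set.range w ∪ Set.range ηs))) ≤
      (Nat.choose (T0 + X.d₀) X.d₀ : ℝ) * ((T1 : ℝ) + 1) ^ X.d₁ := by
    rw [hηsdef, finrank_span_w_box_eq_nn X w hwC η hηY S hS1m]
    exact hVC
  /- ## Théorème 2.1 -/
  obtain ⟨H, hHtop, hHK, hHF, hHineq⟩ := h21 X.d₀ X.d₁ X.ell₀ (∀ m, Fin (S m + 1)) w ηs Kt wt ηts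
    (fun _ => Real.exp Λ) D D D U V T0 T0 T1 hwtKt hηtsKt hone hne
    (fun _ => Real.exp_le_exp.mpr hΛ4) hDe hDe hDe hUpos hVpos hT0₁ hT0₁ hT1₁ h2d hdD
    hH1 hH2 hH3 haw' haη' hU1' hU1' hU2' hUV hlogE hlogE hB2' hexpC' hVC'
  /- ## Théorème 4.1 -/
  set γs : (∀ m, Fin (S m + 1)) → LinGroup X.d₀ X.d₁ := fun s => LinGroup.exp (ηs s) with hγsdef
  set γts : (∀ m, Fin (S m + 1)) → LinGroup X.d₀ X.d₁ := fun s => LinGroup.exp (ηts s) with hγtsdef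
  have hγsr : ∀ s, (∀ i, (⟨Multiplicative.toAdd (γs s).1 i, (hγsK s).1 i⟩ : K) ∈ p.ring) ∧
      ∀ i, (⟨((γs s).2 i : ℂ), (hγsK s).2 i⟩ : K) ∈ p.ring ∧
        (⟨((γs s).2 i : ℂ)⁻¹, inv_mem ((hγsK s).2 i)⟩ : K) ∈ p.ring := by
    intro s
    refine ⟨fun i => ?_, fun i => ⟨?_, ?_⟩⟩
    · rw [exs]; exact hxsr s i
    · rw [eys]; exact hysr s i
    · rw [eysi]; exact hysinv s i
  have hwt' : ∀ j, (∀ i (h : (⟨(w j).1 i, (hw j).1 i⟩ : K) ∈ p.ring), (wt j).1 i = τ ⟨_, h⟩) ∧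
      ∀ i (h : (⟨(w j).2 i, (hw j).2 i⟩ : K) ∈ p.ring), (wt j).2 i = τ ⟨_, h⟩ :=
    fun j => ⟨fun i h => rfl, fun i h => rfl⟩
  have hγts' : ∀ s, (∀ i (h : (⟨Multiplicative.toAdd (γs s).1 i, (hγsK s).1 i⟩ : K) ∈ p.ring),
      Multiplicative.toAdd (γts s).1 i = τ ⟨_, h⟩) ∧
      ∀ i (h : (⟨((γs s).2 i : ℂ), (hγsK s).2 i⟩ : K) ∈ p.ring), ((γts s).2 i : ℂ) = τ ⟨_, h⟩ := by
    intro s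
    refine ⟨fun i h => ?_, fun i h => ?_⟩
    · simp only [hγtsdef, LinGroup.toAdd_exp_fst]
      rw [hηts1τ]
      congr 1
      exact Subtype.ext (exs s i).symm
    · simp only [hγtsdef, LinGroup.coe_exp_snd]
      rw [hηts2τ]
      congr 1
      exact Subtype.ext (eys s i).symm
  set Λ' : ℝ := (D : ℝ) / (T1 * k) with hΛ'def
  have hΛ'1 : 1 ≤ Λ' := by
    rw [hΛ'def, le_div_iff₀ (by positivity), one_mul]
    calc (T1 : ℝ) * k ≤ T1 * k * (2 * k) := le_mul_of_one_le_right (by positivity) (by linarith only [hk1])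
      _ = 2 * k ^ 2 * T1 := by ring
      _ ≤ D := hT1D
  have hHffLg : (Hff : ℝ) ≤ Real.log D := by linarith only [hLH]
  have hh1 : ∀ i : Fin X.d₀, (ffHeight₁ (fun s => (⟨Multiplicative.toAdd (γs s).1 i, (hγsK s).1 i⟩ : K)) : ℝ) ≤
      Real.log D := by
    intro i
    have e : (fun s => (⟨Multiplicative.toAdd (γs s).1 i, (hγsK s).1 i⟩ : K)) =
        fun s : ∀ m, Fin (S m + 1) => ∑ m, (((fun s m => (s m : ℕ)) s m : ℕ) : K) * (fun m => η1 m i) m :=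
      funext fun s => exs s i
    rw [e]
    have h1 := ffHeight₁_natLinearComb_le (fun m => η1 m i) (fun (s : ∀ m, Fin (S m + 1)) m => (s m : ℕ))
    have h2 := ffHeight₁_comp_le' (fun mi : (Fin a ⊕ Fin c) × Fin X.d₀ => η1 mi.1 mi.2) (fun m => (m, i))
    have h3 : ffHeight₁ (fun s : ∀ m, Fin (S m + 1) => ∑ m, ((s m : ℕ) : K) * η1 m i) ≤ Hff :=
      h1.trans (h2.trans hHff1)
    exact le_trans (by exact_mod_cast h3) hHffLg
  have hh2 : ∀ j, (ffHeight₁ (Sum.elim (fun i => (⟨(w j).1 i, (hw j).1 i⟩ : K))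
      (fun i => (⟨(w j).2 i, (hw j).2 i⟩ : K))) : ℝ) ≤ Real.log D :=
    fun j => le_trans (by exact_mod_cast hHff3 j) hHffLg
  have hγKalg : ∀ (m : Fin a) i, IsAlgebraic ℚ (γK (Sum.inl m) i) := hγalg
  have hh3 : ∀ (i : Fin X.d₁) (s : ∀ m, Fin (S m + 1)),
      (ffHeight₁ (fun _ : Unit => (⟨((γs s).2 i : ℂ), (hγsK s).2 i⟩ : K)) : ℝ) ≤
        Real.log (Real.exp Λ') := by
    intro i s
    rw [Real.log_exp, eys]
    have h1 := ffHeight₁_prod_pow_le (fun m => γK m i) (fun m => (s m : ℕ))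
    have h2 : ∑ m, (s m : ℕ) * ffHeight₁ (fun _ : Unit => γK m i) ≤ c * (S2 * Hff) := by
      rw [Fintype.sum_sum_type]
      have ha0 : ∑ m : Fin a, (s (Sum.inl m) : ℕ) * ffHeight₁ (fun _ : Unit => γK (Sum.inl m) i) = 0 := by
        refine Finset.sum_eq_zero fun m _ => ?_
        rw [ffHeight₁_eq_zero_of_isAlgebraic (fun _ => hγKalg m i), mul_zero]
      have hc0 : ∑ m : Fin c, (s (Sum.inr m) : ℕ) * ffHeight₁ (fun _ : Unit => γK (Sum.inr m) i) ≤
          ∑ _m : Fin c, S2 * Hff :=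
        Finset.sum_le_sum fun m _ => Nat.mul_le_mul (hsle s (Sum.inr m)) (hHff2 _ i)
      simp only [Finset.sum_const, Finset.card_univ, Fintype.card_fin, smul_eq_mul] at hc0
      rw [ha0, zero_add]
      exact hc0
    have h3 : ((c * (S2 * Hff) : ℕ) : ℝ) ≤ Λ' := by
      push_cast
      rw [hΛ'def, le_div_iff₀ (by positivity)]
      calc (c : ℝ) * (S2 * Hff) * (T1 * k) = (c * Hff) * (T1 * S2) * k := by ring
        _ ≤ k * (T1 * S2) * k := by gcongr
        _ = k ^ 2 * T1 * S2 := by ring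
        _ ≤ D := hS2le
    calc (ffHeight₁ (fun _ : Unit => ys s i) : ℝ) ≤ ((∑ m, (s m : ℕ) * ffHeight₁ (fun _ : Unit => γK m i) : ℕ) : ℝ) := by
          exact_mod_cast h1
      _ ≤ ((c * (S2 * Hff) : ℕ) : ℝ) := by exact_mod_cast h2
      _ ≤ Λ' := h3
  have hmax : max (2 * (X.d₁ : ℝ) * ((T1 : ℝ) * ∑ _i : Fin X.d₁, Real.log (Real.exp Λ')))
      (2 * (X.d₀ : ℝ) * Real.log D + X.ell₀ * Real.log D) < p.deg := by
    rw [hpD]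
    simp only [Real.log_exp, Finset.sum_const, Finset.card_univ, Fintype.card_fin, nsmul_eq_mul]
    refine max_lt ?_ ?_
    · rw [hΛ'def]
      have e : 2 * (X.d₁ : ℝ) * (T1 * (X.d₁ * (D / (T1 * k)))) = (2 * (X.d₁ : ℝ) ^ 2 / k) * D := by
        field_simp
      rw [e]
      calc (2 * (X.d₁ : ℝ) ^ 2 / k) * D < 1 * D := by
            apply mul_lt_mul_of_pos_right _ hD0
            rw [div_lt_one hk0]; exact hk41
        _ = D := one_mul _
    · have h := Sec5.mul_le_exp_of_ge (M := 2 * (X.d₀ : ℝ) + X.ell₀ + 1) (L := Lg) (by positivity) hL41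
      rw [hLgdef, Real.exp_log hD0] at h
      have : 2 * (X.d₀ : ℝ) * Real.log D + X.ell₀ * Real.log D = (2 * (X.d₀ : ℝ) + X.ell₀ + 1) * Real.log D - Real.log D := by ring
      rw [this]; linarith only [h, hLg0, hLgdef]
  obtain ⟨L, hLK, hLa, hLt, hLn, hLc⟩ := h41 X.d₀ X.d₁ p τ hτ Kt hτKt (hKtD.trans hpD.symm) X.ell₀
    (∀ m, Fin (S m + 1)) T1 w hw hwli γs hγsK H hHK hHF hwr hγsr wt γts hwt' hγts'
    (fun _ => Real.exp Λ') D D (fun _ => Real.exp_le_exp.mpr hΛ'1) hDe hDe hh1 hh2 hh3 hmax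
  /- ## counting the classes of `Σ` modulo `L` (p. 783) -/
  set SL : Submodule ℤ ((Fin X.d₀ → ℂ) × (Fin X.d₁ → ℂ)) :=
    L.tangent.restrictScalars ℤ ⊔ omegaLattice X.d₀ X.d₁ with hSLdef
  set P : Finset (Fin a ⊕ Fin c) := Finset.univ.image Sum.inl with hPdef
  obtain ⟨J, hJ1, hJ2, hJ3⟩ := L.prod_le_ncard_classes η hηli P S
  have hPcard : P.card = a := by
    rw [hPdef, Finset.card_image_of_injective _ Sum.inl_injective]; simp
  have hPspan : Submodule.span ℤ (η '' ↑P) = X.YaSat := by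
    rw [← hηA, hPdef, Finset.coe_image, Finset.coe_univ, Set.image_univ, ← Set.range_comp]
  have hmemP : ∀ m, m ∈ P ↔ ∃ m' : Fin a, m = Sum.inl m' := by
    intro m; rw [hPdef, Finset.mem_image]; simp [eq_comm]
  rw [Fintype.card_sum, Fintype.card_fin, Fintype.card_fin, hηY] at hJ1
  rw [hPcard, hPspan] at hJ2
  -- notation for the ranks
  set rY : ℕ := Module.finrank ℤ ↥(X.Y ⊓ SL) with hrY
  set rA : ℕ := Module.finrank ℤ ↥(X.YaSat ⊓ SL) with hrA
  set jP : ℕ := (J.filter (· ∈ P)).card with hjP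
  have hjPJ : jP ≤ J.card := Finset.card_filter_le _ _
  have hlamJ : X.ell₁ - rY ≤ J.card := by omega
  have hlamA : a - rA ≤ jP := by omega
  -- `∏_{i ∈ J} (S_i + 1) ≥ S1^{jP} S2^{|J| - jP}`
  have hprodS : S1 ^ jP * S2 ^ (J.card - jP) ≤ ∏ i ∈ J, (S i + 1) := by
    have h1 : ∏ i ∈ J, S i ≤ ∏ i ∈ J, (S i + 1) := Finset.prod_le_prod' fun i _ => Nat.le_succ _
    refine le_trans (le_of_eq ?_) h1
    rw [← Finset.prod_filter_mul_prod_filter_not J (· ∈ P)]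
    have e1 : ∏ i ∈ J.filter (· ∈ P), S i = S1 ^ jP := by
      rw [hjP, ← Finset.prod_const]
      refine Finset.prod_congr rfl fun i hi => ?_
      obtain ⟨m', rfl⟩ := (hmemP i).mp (Finset.mem_filter.mp hi).2
      rfl
    have e2 : ∏ i ∈ J.filter (fun i => ¬ i ∈ P), S i = S2 ^ (J.card - jP) := by
      have hc : (J.filter (fun i => ¬ i ∈ P)).card = J.card - jP := by
        have := Finset.card_filter_add_card_filter_not (s := J) (p := (· ∈ P))
        rw [hjP]; omega
      rw [← hc, ← Finset.prod_const]
      refine Finset.prod_congr rfl fun i hi => ?_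
      have hi' := (Finset.mem_filter.mp hi).2
      rcases i with m | m
      · exact absurd ((hmemP _).mpr ⟨m, rfl⟩) hi'
      · rfl
    rw [e1, e2]
  -- `S1^{λₐ'} S2^{λ'-λₐ'} ≤ S1^{jP} S2^{|J|-jP}` (`S1 ≥ S2 ≥ 1`, `λₐ' ≤ jP ≤ |J|`, `λ' ≤ |J|`)
  have hpowle : S1 ^ (a - rA) * S2 ^ ((X.ell₁ - rY) - (a - rA)) ≤ S1 ^ jP * S2 ^ (J.card - jP) := by
    calc S1 ^ (a - rA) * S2 ^ ((X.ell₁ - rY) - (a - rA))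
        ≤ S1 ^ (a - rA) * S2 ^ (J.card - (a - rA)) :=
          Nat.mul_le_mul_left _ (Nat.pow_le_pow_right hS2₁ (by omega))
      _ = S1 ^ (a - rA) * (S2 ^ (jP - (a - rA)) * S2 ^ (J.card - jP)) := by
          rw [← pow_add]; congr 2; omega
      _ ≤ S1 ^ (a - rA) * (S1 ^ (jP - (a - rA)) * S2 ^ (J.card - jP)) :=
          Nat.mul_le_mul_left _ (Nat.mul_le_mul_right _ (Nat.pow_le_pow_left hS21 _))
      _ = S1 ^ jP * S2 ^ (J.card - jP) := by
          rw [← mul_assoc, ← pow_add]; congr 2; omega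
  have hncard : S1 ^ (a - rA) * S2 ^ ((X.ell₁ - rY) - (a - rA)) ≤
      Set.ncard ((QuotientGroup.mk : LinGroup X.d₀ X.d₁ → LinGroup X.d₀ X.d₁ ⧸ H.toSubgroup) '' Set.range γts) :=
    hpowle.trans (hprodS.trans (hJ3.trans hLn))
  -- the exponent of `T₀`
  have hexp0 : X.ell₀ - Module.finrank K ↥(X.W ⊓ L.tangent.restrictScalars K) ≤
      Module.finrank Kt ↥(Submodule.span Kt (Set.range wt)) -
        Module.finrank Kt ↥(Submodule.span Kt (Set.range wt) ⊓ H.tangent.restrictScalars Kt) := by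
    rw [hwW] at hLc; exact hLc
  have haL : L.addDim ≤ X.d₀ := by
    have := Submodule.finrank_le (R := ℂ) L.addPart
    rwa [Module.finrank_fin_fun] at this
  have htL : L.torusDim ≤ X.d₁ := by
    have := Submodule.finrank_le (R := ℂ) L.torusTangent
    rwa [Module.finrank_fin_fun] at this
  have hLtop : L.tangent ≠ ⊤ := by
    intro htop
    apply hHtop
    rw [LinGroup.ConnAlgSubgroup.tangent, Submodule.prod_eq_top_iff] at htop ⊢
    have h0 : Module.finrank ℂ ↥H.addPart = Module.finrank ℂ (Fin X.d₀ → ℂ) := by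
      rw [Module.finrank_fin_fun]
      change H.addDim = X.d₀
      rw [← hLa]
      change Module.finrank ℂ ↥L.addPart = X.d₀
      rw [htop.1, finrank_top, Module.finrank_fin_fun]
    have h1 : Module.finrank ℂ ↥H.torusTangent = Module.finrank ℂ (Fin X.d₁ → ℂ) := by
      rw [Module.finrank_fin_fun]
      change H.torusDim = X.d₁
      rw [← hLt]
      change Module.finrank ℂ ↥L.torusTangent = X.d₁
      rw [htop.2, finrank_top, Module.finrank_fin_fun]
    exact ⟨Submodule.eq_top_of_finrank_eq h0, Submodule.eq_top_of_finrank_eq h1⟩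
  refine ⟨L, hLK, hLtop, ?_⟩
  rw [← ha]
  have hM : 0 < T0 ^ L.addDim * T1 ^ L.torusDim := by positivity
  refine Nat.le_of_mul_le_mul_right ?_ hM
  have e1 : T0 ^ X.d₀ = T0 ^ (X.d₀ - L.addDim) * T0 ^ L.addDim := by
    rw [← pow_add, Nat.sub_add_cancel haL]
  have e2 : T1 ^ X.d₁ = T1 ^ (X.d₁ - L.torusDim) * T1 ^ L.torusDim := by
    rw [← pow_add, Nat.sub_add_cancel htL]
  calc T0 ^ (X.ell₀ - Module.finrank K ↥(X.W ⊓ L.tangent.restrictScalars K)) * S1 ^ (a - rA) *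
        S2 ^ ((X.ell₁ - rY) - (a - rA)) * (T0 ^ L.addDim * T1 ^ L.torusDim)
      ≤ T0 ^ (Module.finrank Kt ↥(Submodule.span Kt (Set.range wt)) -
          Module.finrank Kt ↥(Submodule.span Kt (Set.range wt) ⊓ H.tangent.restrictScalars Kt)) *
        Set.ncard ((QuotientGroup.mk : LinGroup X.d₀ X.d₁ → LinGroup X.d₀ X.d₁ ⧸ H.toSubgroup) '' Set.range γts) *
        (T0 ^ H.addDim * T1 ^ H.torusDim) := by
        rw [hLa, hLt, mul_assoc (T0 ^ _) (S1 ^ _)]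
        exact Nat.mul_le_mul (Nat.mul_le_mul (Nat.pow_le_pow_right hT0₁ hexp0) hncard) le_rfl
    _ = T0 ^ (Module.finrank Kt ↥(Submodule.span Kt (Set.range wt)) -
          Module.finrank Kt ↥(Submodule.span Kt (Set.range wt) ⊓ H.tangent.restrictScalars Kt)) *
        Set.ncard ((QuotientGroup.mk : LinGroup X.d₀ X.d₁ → LinGroup X.d₀ X.d₁ ⧸ H.toSubgroup) '' Set.range γts) *
        T0 ^ H.addDim * T1 ^ H.torusDim := by ring
    _ ≤ (X.d₀ + X.d₁).factorial / X.d₀.factorial * T0 ^ X.d₀ * T1 ^ X.d₁ := hHineq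
    _ = (X.d₀ + X.d₁).factorial / X.d₀.factorial * T0 ^ (X.d₀ - L.addDim) * T1 ^ (X.d₁ - L.torusDim) *
        (T0 ^ L.addDim * T1 ^ L.torusDim) := by rw [e1, e2]; ring

end RoyWaldschmidt1997

end Literature.NumberTheory.Transcendental
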